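import Summits.CriticalPhenomena.PercolationContinuityZ3.Theorems.PercNearOneGluingNoHeavyQuantSingleGateDominant
import HarnessLib

/-!
# QUANT lane R8, T-DEC, leg (III): THE BLOB STEP (PM / the gate move) HOLDS AT EVERY DOMINANT LAYER, FOR EVERY BLOB SIZE —
# an unconditional corollary of `gateConv_tail_ge_of_hdecAtT` (the gated blob `{0, a; qg}` is a heavy datum at every layer)

builds on p205010 (kernel theorem, internal audit signed; external expert review pending)

Support file (`--supports stmt-CriticalPhenomena-4575`), QUANT lane seat prim-quant-arm-2 (gen 34), rung R8 of
`run/shared/lean/prim/quant/LADDER.md`.  Theorems only, standard axioms, no sorries.  Uses this seat's `…QuantSingleGateDominant`.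

WHAT.  In the binder of `SingleGateConvClosed` take the second factor to be the blob `μ₂ = {0, a; g}` (`a ≥ 1`, `0 ≤ g ≤ 1`): its gated law
`gate_q μ₂ = {0: 1 − qg, a: qg}` is ONE two-point component, HEAVY-valid at every layer `j` as soon as `y ≤ q·g` (a giant pair for `j < a`,
a credit pair with credit `a·qg = q·T₂` for `j ≥ a`) — `hdecAtT_gate_blob`.  Hence (`gateConv_blob_tail_ge_dominant`, `gateConv_blob_decAt_dominant`):
**for every probability law `μ₁` on `{0..M₁}` whose gated law `gate_q μ₁` is top-affordable and DEC at every layer below its top, every blob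
`(a, g)` with `y ≤ qg`, and every DOMINANT layer `2j < q(T₁ + ga)`, the gated convolution `gate_q(μ₁ ∗ {0,a;g})` — the conclusion law of the
blob step PM / of lead g30's window form CW / of typer g27's move lemma (M) — is DEC(j).**  The proof reads `gate_q μ₁`'s datum at the ONE
layer `j` (`deepLows_le_giants` at `i = j`, `i′ = j − a`) plus its top-affordability: at dominant layers a single datum suffices, whereas every
one-layer form of the blob step is refuted at NON-dominant layers (README V313 `not_mixedShiftDEC`, V317 TwinMoveDEC, V318 (M) without `hsupp`:
the V318 witness fails exactly at the layers `j = 3..19` with `2j ≥ t ≈ 4.01`).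
HONEST STATUS: dominant layers only; the window form CW, `GateMove`, `SingleGateConvClosed`, `TreeDEC`, `FarTreeRow` remain OPEN; the RATE
class log\* and the honest sentence of `run/shared/lean/prim/quant/README.md` are unchanged.

[this work]; blob step: prim-quant-stmt g27, prim-quant-lead g28–g30, prim-quant-arm-1 g38–g39 (this lane).  Nothing here is cited as a
published result.  The gluing rows served [cite: KozmaNitzan2024, Conjecture 3 (p. 15)]; product measure [cite: Grimmett1999, §1.3 p. 10].
-/

noncomputable section

namespace Summit.CriticalPhenomena.PercolationContinuityZ3.Theorems

namespace Quant

open Finset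

/-- the two-point law `{lo, hi; g}` (as in `…QuantLawDEC`) -/
local notation3 "TP[" lo ", " hi ", " g ", " h "]" =>
  (g : ℝ) * (if (h : ℕ) = (hi : ℕ) then (1 : ℝ) else 0) + (1 - (g : ℝ)) * (if (h : ℕ) = (lo : ℕ) then (1 : ℝ) else 0)

namespace LawDec

/-- **the gated blob is a heavy datum at every layer**: for `a ≥ 1`, `0 ≤ g ≤ 1`, `0 ≤ q ≤ 1`, `y ≤ q·g`, the law
`gate_q {0, a; g} = {0: 1 − qg, a: qg}` is `HDECAtT y (q·(g·a)) j a` for every `j` (one component `{0, a; qg}`: a giant pair if `j < a`,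
a heavy credit pair with credit `a·qg` if `a ≤ j`). [this work] -/
theorem hdecAtT_gate_blob (y q g : ℝ) (a j : ℕ) (ha : 1 ≤ a) (hg0 : 0 ≤ g) (hg1 : g ≤ 1) (hq0 : 0 ≤ q) (hq1 : q ≤ 1)
    (hyqg : y ≤ q * g) :
    HDECAtT y (q * (g * a)) j a (gate (fun h => TP[0, a, g, h]) q) := by
  refine ⟨Unit, inferInstance, fun _ => 1, fun _ => q * g, fun _ => 0, fun _ => a, fun _ => zero_le_one, by simp,
    fun _ => ⟨mul_nonneg hq0 hg0, by nlinarith⟩, fun _ => Nat.zero_le a, fun _ => le_rfl, fun h => ?_, fun _ _ => ?_⟩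
  · -- the law identity `gate_q {0,a;g} = {0, a; qg}`
    simp only [Finset.univ_unique, Finset.sum_singleton, gate_apply, one_mul]
    have ha0 : ¬ ((0 : ℕ) = a) := by omega
    by_cases h0 : h = 0
    · subst h0
      rw [if_neg ha0, if_pos rfl]
      ring
    · rw [if_neg h0]
      ring
  · -- heavy validity at layer `j`
    dsimp only
    by_cases hja : j + 1 ≤ a
    · exact Or.inr (Or.inl ⟨by omega, hja, hyqg⟩)
    · refine Or.inr (Or.inr ⟨by omega, by omega, hyqg, le_of_eq ?_⟩)
      push_cast
      ring

/-- **THE BLOB STEP AT EVERY DOMINANT LAYER (far row).**  `0 < y < 1`, `y ≤ q ≤ 1`; `μ₁` a probability law on `{0..M₁}` (mean `T₁`) with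
`gate_q μ₁` top-affordable (`y·M₁ ≤ q·T₁`) and DEC(j′) at every `j′ < M₁`; a blob `(a ≥ 1, 0 ≤ g ≤ 1)` with `y ≤ q·g`; a layer `j` with
`2j < q·(T₁ + g·a)`.  Then `y ≤ Σ_{j < h ≤ M₁ + a} gate_q(μ₁ ∗ {0, a; g}) h`. [this work] -/
theorem gateConv_blob_tail_ge_dominant (y q g T₁ : ℝ) (a j M₁ : ℕ) (μ₁ : ℕ → ℝ)
    (hy0 : 0 < y) (hy1 : y < 1) (hyq : y ≤ q) (hq1 : q ≤ 1) (ha : 1 ≤ a) (hg0 : 0 ≤ g) (hg1 : g ≤ 1) (hyqg : y ≤ q * g)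
    (h10 : ∀ h, 0 ≤ μ₁ h) (h1M : ∀ h, M₁ < h → μ₁ h = 0) (h11 : ∑ h ∈ Finset.range (M₁ + 1), μ₁ h = 1)
    (hT₁ : ∑ h ∈ Finset.range (M₁ + 1), (h : ℝ) * μ₁ h = T₁) (hta : y * (M₁ : ℝ) ≤ q * T₁)
    (hdec : ∀ j', j' < M₁ → DECAt y j' M₁ (gate μ₁ q)) (hdom : 2 * (j : ℝ) < q * (T₁ + g * a)) :
    y ≤ ∑ h ∈ Finset.Ico (j + 1) (M₁ + a + 1), gate (lconv M₁ a μ₁ (fun h => TP[0, a, g, h])) q h := by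
  have hq0 : 0 < q := hy0.trans_le hyq
  have hb0 : ∀ h, 0 ≤ TP[0, a, g, h] := fun h => by
    have : 0 ≤ 1 - g := by linarith
    positivity
  have hb1 : ∑ h ∈ Finset.range (a + 1), TP[0, a, g, h] = 1 := by
    rw [Finset.sum_add_distrib, ← Finset.mul_sum, ← Finset.mul_sum, Finset.sum_ite_eq' (Finset.range (a + 1)) a,
      if_pos (Finset.mem_range.2 (by omega)), Finset.sum_ite_eq' (Finset.range (a + 1)) 0,
      if_pos (Finset.mem_range.2 (by omega))]
    ring
  exact gateConv_tail_ge_of_hdecAtT y q T₁ (g * a) j M₁ a μ₁ (fun h => TP[0, a, g, h]) hy0 hy1 hyq hq1 h10 h1M h11 hT₁ hta hdec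
    hb0 hb1 (hdecAtT_gate_blob y q g a j ha hg0 hg1 hq0.le hq1 hyqg) hdom

/-- **THE BLOB STEP AT EVERY DOMINANT LAYER (DEC form)**: as `gateConv_blob_tail_ge_dominant`; then `gate_q(μ₁ ∗ {0, a; g})` is
`DECAt y j (M₁ + a)` — the conclusion of PM / CW / (M) at the layer `j`, for every blob size `a`. [this work] -/
theorem gateConv_blob_decAt_dominant (y q g T₁ : ℝ) (a j M₁ : ℕ) (μ₁ : ℕ → ℝ)
    (hy0 : 0 < y) (hy1 : y < 1) (hyq : y ≤ q) (hq1 : q ≤ 1) (ha : 1 ≤ a) (hg0 : 0 ≤ g) (hg1 : g ≤ 1) (hyqg : y ≤ q * g)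
    (h10 : ∀ h, 0 ≤ μ₁ h) (h1M : ∀ h, M₁ < h → μ₁ h = 0) (h11 : ∑ h ∈ Finset.range (M₁ + 1), μ₁ h = 1)
    (hT₁ : ∑ h ∈ Finset.range (M₁ + 1), (h : ℝ) * μ₁ h = T₁) (hta : y * (M₁ : ℝ) ≤ q * T₁)
    (hdec : ∀ j', j' < M₁ → DECAt y j' M₁ (gate μ₁ q)) (hdom : 2 * (j : ℝ) < q * (T₁ + g * a)) :
    DECAt y j (M₁ + a) (gate (lconv M₁ a μ₁ (fun h => TP[0, a, g, h])) q) := by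
  have hq0 : 0 < q := hy0.trans_le hyq
  have hb0 : ∀ h, 0 ≤ TP[0, a, g, h] := fun h => by
    have : 0 ≤ 1 - g := by linarith
    positivity
  have hb1 : ∑ h ∈ Finset.range (a + 1), TP[0, a, g, h] = 1 := by
    rw [Finset.sum_add_distrib, ← Finset.mul_sum, ← Finset.mul_sum, Finset.sum_ite_eq' (Finset.range (a + 1)) a,
      if_pos (Finset.mem_range.2 (by omega)), Finset.sum_ite_eq' (Finset.range (a + 1)) 0,
      if_pos (Finset.mem_range.2 (by omega))]
    ring
  exact gateConv_decAt_of_hdecAtT_dominant y q T₁ (g * a) j M₁ a μ₁ (fun h => TP[0, a, g, h]) hy0 hy1 hyq hq1 h10 h1M h11 hT₁ hta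
    hdec hb0 hb1 (hdecAtT_gate_blob y q g a j ha hg0 hg1 hq0.le hq1 hyqg) hdom

end LawDec

end Quant

end Summit.CriticalPhenomena.PercolationContinuityZ3.Theorems
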